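import Summits.CriticalPhenomena.PercolationContinuityZ3.Theorems.PercNearOneGluingNoHeavyLowerTailFrontierDecRowsRow37ThreeOneCutB
import HarnessLib

/-!
# Row 37 across every cut vertex isolating a LEAF (route `PercNearOneGluingNoHeavy`, supports-only; prim-l12-p6 g16)

Frontier dec row 37 is `E₃(D[ab|c], D[ac|y], D[ay|b]) ≥ 0`; its stabiliser in `S₄` is the 3-cycle `(b c y)` (`sahiE3_row37_cycle`:
row 37 at `(a,c,y,b)` is the same triple of events, cyclically permuted).  The leaf case `b` (`…Row37ThreeOneCutB`, three Harris
brackets + IH) therefore gives the leaves `c` and `y`: for every cut vertex `h` isolating ONE leaf `t ∈ {b,c,y}` of row 37 from the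
other three terminals, row 37 at the placement with `t ↦ h` implies row 37 at `(a,b,c,y)`.  The hub `a` is `…Row37ThreeOneCutA`
(modulo three row-15 instances).  Memo `run/shared/lean/prim/prim-l12/FROM-prim-l12-p6-g16-ROW37-HUB-IDENTITY.md` §2.
No definitions, no named facts, no sorries.
-/

noncomputable section

namespace Summit.CriticalPhenomena.PercolationContinuityZ3.Theorems.FrontierDecRows

open MeasureTheory CovTransferCert E3GroupSepCert
open Literature.Probability.Percolation Literature.Probability.LatticeModels

variable {n : ℕ}

/-- Row 37 is invariant under the 3-cycle `(b c y)`: the placement `(a,c,y,b)` lists the same three events cyclically. [this work] -/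
theorem sahiE3_row37_cycle (μ : Measure (BondConfig (Fin n))) (a b c y : Fin n) :
    sahiE3 μ (connEvent (row 37 n (a, c, y, b)).1) (connEvent (row 37 n (a, c, y, b)).2.1) (connEvent (row 37 n (a, c, y, b)).2.2) =
      sahiE3 μ (connEvent (row 37 n (a, b, c, y)).1) (connEvent (row 37 n (a, b, c, y)).2.1)
        (connEvent (row 37 n (a, b, c, y)).2.2) := by
  have h1 : row 37 n (a, c, y, b) = (sep [a, c] [y], sep [a, y] [b], sep [a, b] [c]) := rfl
  have h2 : row 37 n (a, b, c, y) = (sep [a, b] [c], sep [a, c] [y], sep [a, y] [b]) := rfl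
  simp only [h1, h2]
  rw [sahiE3_comm₂₃, sahiE3_comm₁₂]

/-- **Lone leaf `c`** (`{a,b,y} | {c}`): row 37 at `(a,b,h,y)` ⟹ row 37 at `(a,b,c,y)`. [this work] -/
theorem sahiE3_row37_nonneg_of_threeOneCut_c (w : Sym2 (Fin n) → unitInterval) (a b c y h : Fin n) (side : Fin n → Bool)
    (ha : side a = true) (hb : side b = true) (hy : side y = true) (hc : side c = false)
    (hw : ∀ u v : Fin n, u ≠ h → v ≠ h → side u ≠ side v → w s(u, v) = 0)
    (h37 : 0 ≤ sahiE3 (prodBernoulli w) (connEvent (row 37 n (a, b, h, y)).1) (connEvent (row 37 n (a, b, h, y)).2.1)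
      (connEvent (row 37 n (a, b, h, y)).2.2)) :
    0 ≤ sahiE3 (prodBernoulli w) (connEvent (row 37 n (a, b, c, y)).1) (connEvent (row 37 n (a, b, c, y)).2.1)
      (connEvent (row 37 n (a, b, c, y)).2.2) := by
  rw [← sahiE3_row37_cycle]
  rw [← sahiE3_row37_cycle] at h37
  exact sahiE3_row37_nonneg_of_threeOneCut_b w a c y b h side ha hy hb hc hw h37

/-- **Lone leaf `y`** (`{a,b,c} | {y}`): row 37 at `(a,b,c,h)` ⟹ row 37 at `(a,b,c,y)`. [this work] -/
theorem sahiE3_row37_nonneg_of_threeOneCut_y (w : Sym2 (Fin n) → unitInterval) (a b c y h : Fin n) (side : Fin n → Bool)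
    (ha : side a = true) (hb : side b = true) (hc : side c = true) (hy : side y = false)
    (hw : ∀ u v : Fin n, u ≠ h → v ≠ h → side u ≠ side v → w s(u, v) = 0)
    (h37 : 0 ≤ sahiE3 (prodBernoulli w) (connEvent (row 37 n (a, b, c, h)).1) (connEvent (row 37 n (a, b, c, h)).2.1)
      (connEvent (row 37 n (a, b, c, h)).2.2)) :
    0 ≤ sahiE3 (prodBernoulli w) (connEvent (row 37 n (a, b, c, y)).1) (connEvent (row 37 n (a, b, c, y)).2.1)
      (connEvent (row 37 n (a, b, c, y)).2.2) := by
  rw [← sahiE3_row37_cycle, ← sahiE3_row37_cycle]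
  rw [← sahiE3_row37_cycle, ← sahiE3_row37_cycle] at h37
  exact sahiE3_row37_nonneg_of_threeOneCut_b w a y b c h side ha hb hc hy hw h37

end Summit.CriticalPhenomena.PercolationContinuityZ3.Theorems.FrontierDecRows

end
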